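import Summits.CriticalPhenomena.PercolationContinuityZ3.Theorems.PercNearOneGluingNoHeavyPcintMeanMemFastSound
import HarnessLib

/-!
# PCINT lane, reduced-state B3m certificates (bond), fast kernel format: occupancy masks

Cell `prim-pcint` (PAPER-2 track (iii)), seat `prim-pcint-2` (gen 11); support file (`--supports stmt-CriticalPhenomena-4575`).
Does NOT build on p205010.  The bit-level bridges for the mask tests of `…PcintMeanMemFast` (`BondF.occOf`, `BondF.maskOf`,
`BondF.nbMask`): bits of a mask are exactly the cells of the listed sites (`testBit_occOf`, `testBit_maskOf`, by `Nat.testBit_or` /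
`Nat.testBit_two_pow` — an OR of powers of two needs no disjointness), `cell7` is injective near the endpoint (`cell7_inj`), whence
on a well-formed state: a missed cell is an absent site (`forall_ne_of_mask`), a common bit of an age-filtered occupancy mask and a
neighbour mask is a remembered incidence with that age property (`exists_of_mask`), and a missed neighbour mask means no such
incidence (`forall_not_adj_of_mask`).
-/

namespace Summit.CriticalPhenomena.PercolationContinuityZ3.Theorems.Pcint

open Finset Literature.Probability.Percolation Literature.Probability.LatticeModels

namespace BondF

open NawK (letters letterIdx mem_letters)

variable {d : ℕ}

/-! ### Bits of masks -/

/-- Bits of an occupancy mask. [folklore] -/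
theorem testBit_occOf {p : ℕ → Bool} : ∀ {l : List (ℕ × ℕ × ℕ)} {i : ℕ},
    (occOf p l).testBit i = true ↔ ∃ e ∈ l, p e.2.2 = true ∧ e.2.1 = i
  | [], i => by simp [occOf]
  | e :: l, i => by
    unfold occOf
    by_cases hp : p e.2.2 = true
    · rw [if_pos hp, Nat.testBit_or, Bool.or_eq_true, Nat.testBit_two_pow, decide_eq_true_eq, testBit_occOf]
      constructor
      · rintro (h | ⟨e', he', hp', hi⟩)
        · exact ⟨e, by simp, hp, h⟩
        · exact ⟨e', by simp [he'], hp', hi⟩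
      · rintro ⟨e', he', hp', hi⟩
        rcases List.mem_cons.1 he' with rfl | he'
        · exact Or.inl hi
        · exact Or.inr ⟨e', he', hp', hi⟩
    · rw [if_neg hp, testBit_occOf]
      constructor
      · rintro ⟨e', he', hp', hi⟩; exact ⟨e', by simp [he'], hp', hi⟩
      · rintro ⟨e', he', hp', hi⟩
        rcases List.mem_cons.1 he' with rfl | he'
        · exact absurd hp' hp
        · exact ⟨e', he', hp', hi⟩

/-- Bits of a site mask. [folklore] -/
theorem testBit_maskOf {B : ℕ} : ∀ {l : List (List ℕ)} {i : ℕ}, (maskOf B l).testBit i = true ↔ ∃ v ∈ l, cell7 B v = i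
  | [], i => by simp [maskOf]
  | v :: l, i => by
    unfold maskOf
    rw [Nat.testBit_or, Bool.or_eq_true, Nat.testBit_two_pow, decide_eq_true_eq, testBit_maskOf]
    constructor
    · rintro (h | ⟨v', hv', hi⟩)
      · exact ⟨v, by simp, h⟩
      · exact ⟨v', by simp [hv'], hi⟩
    · rintro ⟨v', hv', hi⟩
      rcases List.mem_cons.1 hv' with rfl | hv'
      · exact Or.inl hi
      · exact Or.inr ⟨v', hv', hi⟩

/-- A nonzero `&&&` has a common bit. [folklore] -/
theorem exists_testBit_of_land_ne_zero {x y : ℕ} (h : x &&& y ≠ 0) : ∃ i, x.testBit i = true ∧ y.testBit i = true := by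
  obtain ⟨i, hi⟩ := Nat.exists_testBit_of_ne_zero h
  rw [Nat.testBit_and, Bool.and_eq_true] at hi
  exact ⟨i, hi⟩

/-- A zero `&&&` has no common bit. [folklore] -/
theorem not_testBit_of_land_eq_zero {x y : ℕ} (h : x &&& y = 0) (i : ℕ) : ¬ (x.testBit i = true ∧ y.testBit i = true) := by
  intro hi
  have := Nat.testBit_and x y i
  rw [h, Nat.zero_testBit, hi.1, hi.2] at this
  exact Bool.noConfusion this

/-- A norm bound bounds every coordinate. [folklore] -/
theorem bound_of_l1F {B n : ℕ} : ∀ {v : List ℕ}, l1F B v ≤ n → ∀ x ∈ v, B ≤ x + n ∧ x ≤ B + n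
  | [], _, x, hx => by simp at hx
  | y :: v, h, x, hx => by
    simp only [l1F] at h
    rcases List.mem_cons.1 hx with rfl | hx
    · split_ifs at h <;> omega
    · exact bound_of_l1F (v := v) (by omega) x hx

/-- `cell7` is injective on sites within `ℓ∞`-distance `3` of the endpoint. [folklore] -/
theorem cell7_inj {B : ℕ} : ∀ {v w : List ℕ}, v.length = w.length → (∀ x ∈ v, B ≤ x + 3 ∧ x ≤ B + 3) →
    (∀ x ∈ w, B ≤ x + 3 ∧ x ≤ B + 3) → cell7 B v = cell7 B w → v = w
  | [], [], _, _, _, _ => rfl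
  | [], _ :: _, h, _, _, _ => by simp at h
  | _ :: _, [], h, _, _, _ => by simp at h
  | x :: v, y :: w, hl, hv, hw, h => by
    simp only [cell7] at h
    have hx := hv x (by simp)
    have hy := hw y (by simp)
    have h1 : x = y := by omega
    have h2 : cell7 B v = cell7 B w := by omega
    rw [h1, cell7_inj (by simpa using hl) (fun z hz => hv z (by simp [hz])) (fun z hz => hw z (by simp [hz])) h2]

/-! ### Masks of a well-formed state -/

section Masks

variable {B kc : ℕ} {L : FState} (hL : WFF d B L = true)
include hL

/-- **Mask absence**: if the all-sites mask misses the cell of a near site `w`, no remembered site is `w`. [folklore] -/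
theorem forall_ne_of_mask {w : List ℕ} (hw : w.length = d) (hw3 : l1F B w ≤ 3)
    (h : (locOf B kc L).2.2.1 &&& 2 ^ cell7 B w = 0) : ∀ q ∈ (toMF B L : MState d), q.1 ≠ toSiteF B w := by
  intro q hq hqw
  obtain ⟨e, he, rfl⟩ := mem_toMF.1 hq
  have hew : e.1 = w := toSiteF_inj (WFF_spec hL e he).1 hw hqw
  refine not_testBit_of_land_eq_zero h (cell7 B w) ⟨?_, by rw [Nat.testBit_two_pow, decide_eq_true_eq]⟩
  exact testBit_occOf.2 ⟨(code64 e.1, cell7 B e.1, e.2), mem_nearL.2 ⟨e, he, by rw [hew]; exact hw3, rfl⟩, rfl, by rw [hew]⟩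

omit hL in
/-- Members of the neighbour-site list. [folklore] -/
theorem mem_nbSites {w v : List ℕ} : v ∈ (letters d).map (fun k => addU w k.1.1 k.2) ↔ ∃ k : Fin d × Bool, v = addU w k.1.1 k.2 := by
  rw [List.mem_map]
  constructor
  · rintro ⟨k, -, rfl⟩; exact ⟨k, rfl⟩
  · rintro ⟨k, rfl⟩; exact ⟨k, mem_letters k, rfl⟩

/-- **Mask presence**: a common bit of an age-filtered occupancy mask and the neighbour mask of `w` (a site within `ℓ∞`-distance
`2`, positive coordinates) is a remembered incidence of `w` with that age property. [folklore] -/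
theorem exists_of_mask {p : ℕ → Bool} {w : List ℕ} (hw : w.length = d) (hw1 : ∀ x ∈ w, 1 ≤ x)
    (hw2 : ∀ x ∈ w, B ≤ x + 2 ∧ x ≤ B + 2) (h : occOf p (nearL B L) &&& nbMask d B w ≠ 0) :
    ∃ e ∈ L, p e.2 = true ∧ ∃ k : Fin d × Bool, e.1 = addU w k.1.1 k.2 ∧ (zdGraph d).Adj (toSiteF B e.1 : Site d) (toSiteF B w) := by
  have hall := WFF_spec hL
  obtain ⟨i, hi1, hi2⟩ := exists_testBit_of_land_ne_zero h
  obtain ⟨x, hx, hpx, hxi⟩ := testBit_occOf.1 hi1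
  obtain ⟨e, he, he3, rfl⟩ := mem_nearL.1 hx
  obtain ⟨v, hv, hvi⟩ := (testBit_maskOf (B := B)).1 (by rw [nbMask] at hi2; exact hi2)
  obtain ⟨k, rfl⟩ := mem_nbSites.1 hv
  simp only at hpx hxi
  have heq : e.1 = addU w k.1.1 k.2 := by
    refine cell7_inj (by rw [length_addU, hw]; exact (hall e he).1) (bound_of_l1F he3) (fun x hx => ?_) (by rw [hxi, hvi])
    have hlo := addU_ge (n := B - 3) w k.1.1 k.2 (fun y hy => by have := (hw2 y hy).1; have := hw1 y hy; omega) x hx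
    have hhi := addU_le (m := B + 2) w k.1.1 k.2 (fun y hy => (hw2 y hy).2) x hx
    omega
  refine ⟨e, he, hpx, k, heq, ?_⟩
  rw [heq, toSiteF_addU hw hw1 k]
  exact ((zdGraph_adj_iff_stepVec _ _).2 ⟨k, rfl⟩).symm

/-- **Mask absence at the neighbours**: if an age-filtered occupancy mask misses the neighbour mask of `c` (norm `≤ 2`, positive
coordinates), no remembered site with that age property is adjacent to `c`. [folklore] -/
theorem forall_not_adj_of_mask {p : ℕ → Bool} {c : List ℕ} (hc : c.length = d) (hc1 : ∀ x ∈ c, 1 ≤ x) (hc2 : l1F B c ≤ 2)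
    (h : occOf p (nearL B L) &&& nbMask d B c = 0) :
    ∀ e ∈ L, p e.2 = true → ¬ (zdGraph d).Adj (toSiteF B c : Site d) (toSiteF B e.1) := by
  intro e he hp hadj
  obtain ⟨k, hk⟩ := exists_letter_of_adj hc hc1 (WFF_spec hL e he).1 hadj
  have he3 : l1F B e.1 ≤ 3 := by rw [hk]; have := l1F_addU_le (B := B) c k.1.1 k.2; omega
  refine not_testBit_of_land_eq_zero h (cell7 B e.1) ⟨?_, ?_⟩
  · exact testBit_occOf.2 ⟨(code64 e.1, cell7 B e.1, e.2), mem_nearL.2 ⟨e, he, he3, rfl⟩, hp, rfl⟩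
  · rw [nbMask]; exact testBit_maskOf.2 ⟨e.1, mem_nbSites.2 ⟨k, hk⟩, rfl⟩

end Masks

end BondF

end Summit.CriticalPhenomena.PercolationContinuityZ3.Theorems.Pcint
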